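import Literature.NumberTheory.EllipticCurves.HeegnerGeomGaloisTransferProofs
import Literature.NumberTheory.EllipticCurves.HeegnerTraceRelationDividingProofs
import HarnessLib

/-!
# The principal Heegner points `P[c]` as a COHERENT system in `E(K̄)` and their vertical distribution
# relation `Tr_{K[pc]/K[c]} P[pc] = a_p P[c] − P[c/p]` (`p ∣ c`) over transversals of `Gal(K̄/K[pc])` in `Gal(K̄/K[c])`

Topic `NumberTheory/EllipticCurves` (complex multiplication / Heegner points). THEOREMS ONLY (no definition,
no named fact; net Literature debt `0`). Cell `bsd-print-x9`, seat x9-p1 (LEAD, crux stmt-BirchSwinnertonDyer-25235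
and its PIN-1 twin): envelope infrastructure part II. Gross 1991 §3 / Darmon 2004 Prop. 3.10 (case `ℓ ∣ n`) /
Perrin-Riou 1987 §3.1: the Heegner points `x_β(c) = P[c]` of conductor `c` for ONE fixed orientation and ONE
fixed tower of orders `𝒪_{cp} ⊂ 𝒪_c` form a compatible system, `Tr_{K[cp]/K[c]} P[cp] = a_p P[c] − P[c/p]`
for `p ∣ c`, `gcd(cp, N) = 1`. The relation is the tree THEOREM
`HeegnerTraceDividing.finsum_mem_ringClassGalOver_eq_frobeniusTrace_smul_sub` for Gross's principal points
`φ(x_β(c)) ∈ E(K[c]) ⊂ E(ℂ)`; here it is TRANSPORTED into the `Γ_K`-module `E(K̄)` of `HeegnerModuleIndex`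
(`geomPoints`, `IsHeegnerGeomPoint`, `ringClassSubgroup`, transversal sums — the currency of `HeegnerFamily`,
`CastellaGrossiLeeSkinner2022.StabilizedHeegnerData`, `heegnerModule`, `stabilizedHeegnerModule`) through the
dictionary `HeegnerGeomGaloisTransferProofs`: §1 the principal point of conductor `c` EXISTS in `E(K̄)` with
prescribed complex point (hence all conductors share one CM system — COHERENT data, unlike independent `choose`s
on `exists_isHeegnerNormPoint`), §2 the distribution relation over any transversal.

HONEST FRAMING: classical CM (Shimura reciprocity is inside the cited tree theorems); nothing on
`L`-functions, Selmer groups or BSD is asserted. References: [GrossLMS1991] §3 Prop. 3.7; [Darmon2004]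
Prop. 3.10 (case ℓ ∣ n); [PerrinRiou1987BSMF] §3.1; [Howard2004HeegnerKolyvagin] §2.7 (the points P[m]).
-/

set_option autoImplicit false

noncomputable section

open scoped Classical

namespace Literature.NumberTheory.EllipticCurves

open WeierstrassCurve RingClassField ModularForms

variable {K : Type} [Field K] [NumberField K]

/-! ## §1 The principal Heegner point of conductor `c` inside `E(K̄)` -/

/-- **Gross's principal Heegner point `P[c] = φ(x_β(c))` lives in `E(K̄)`, with prescribed complex point.**
For `W/ℚ` elliptic with a parametrisation datum at level `N`, `K` imaginary quadratic with the Heegner hypothesis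
for `N`, an orientation `β` (`4N ∣ β² − d_K`), `c ≠ 0` prime to `N` and `jbar : K̄ → ℂ`: there are
`x ∈ E(K̄)` and `P ∈ E(K[c])` (`K[c] = ringClassField K ι c ⊂ ℂ`, `ι = jbar ∘ (K → K̄)`) with
`x_ℂ = P_ℂ = φ(x_β(c))` — the SAME point for every use, so that points of different conductors form Gross's
compatible system; `x` is a Heegner geometric point of conductor `c` (`IsHeegnerGeomPoint`) fixed by
`Gal(K̄/K[c]) = ringClassSubgroup K c jbar`. (Rationality: the tree theorem
`phi_heegnerPointOfConductor_mem_range_map_ringClassField_holds`, Gross §3 / Darmon Thm. 3.6; transfer to `K̄`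
as in `exists_isHeegnerNormPoint_holds`.) [cite: GrossLMS1991, §3 (x_n ∈ X_0(N)(K_n), y_n = φ(x_n) ∈ E(K_n))]
[cite: Howard2004HeegnerKolyvagin, §2.7 (P[m] ∈ E(K[m]))] -/
theorem exists_geomPoint_principal {N : ℕ} [NeZero N] {W : WeierstrassCurve ℚ} [W.IsElliptic]
    (hK : IsImaginaryQuadratic K) (hH : SatisfiesHeegnerHypothesis N K) (Dt : ModularParametrizationData W N)
    {β : ℤ} (hβ : (4 * N : ℤ) ∣ β ^ 2 - NumberField.discr K) (jbar : AlgebraicClosure K →+* ℂ)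
    {c : ℕ} (hc : c ≠ 0) (hcN : c.Coprime N) :
    ∃ (x : WeierstrassCurve.geomPoints (W.baseChange K))
      (P : (W.baseChange (ringClassField K (jbar.comp (algebraMap K (AlgebraicClosure K))) c)).toAffine.Point),
      complexPoint W jbar x = heegnerPointComplexOfConductor Dt (NumberField.discr K) β c ∧
      WeierstrassCurve.Affine.Point.map (W' := W)
        (ringClassField K (jbar.comp (algebraMap K (AlgebraicClosure K))) c).subtype.toRatAlgHom P =
        heegnerPointComplexOfConductor Dt (NumberField.discr K) β c ∧
      IsHeegnerGeomPoint N W K Dt β c jbar x ∧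
      ∀ σ ∈ ringClassSubgroup K c jbar, σ • x = x := by
  set Kbar := AlgebraicClosure K
  set ι : K →+* ℂ := jbar.comp (algebraMap K Kbar) with hι
  -- (1) rationality over `K[c] ⊂ ℂ`
  obtain ⟨P, hP⟩ := phi_heegnerPointOfConductor_mem_range_map_ringClassField_holds N W K hK hH Dt β ι
    c hβ hc hcN
  obtain ⟨hQ, hQβ⟩ := heegnerFormOfConductor_mem_heegnerForms (N := N) hK.discr_neg hβ hc
  have hQ' : heegnerFormOfConductor (NumberField.discr K) β c ∈
      heegnerForms N (NumberField.discr K * (c : ℤ) ^ 2) := by rwa [mul_comm]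
  have hbc : (W.baseChange K).map (Algebra.ofId K Kbar : K →+* Kbar) = W.baseChange Kbar :=
    W.map_baseChange (Algebra.ofId K Kbar)
  -- (2) transfer to `E(K̄)`
  have key : ∃ x : WeierstrassCurve.geomPoints (W.baseChange K),
      complexPoint W jbar x = heegnerPointComplexOfConductor Dt (NumberField.discr K) β c ∧
        ∀ σ ∈ ringClassSubgroup K c jbar, σ • x = x := by
    rcases hPc : P with _ | ⟨u, v, huv⟩
    · refine ⟨0, ?_, fun σ _ ↦ smul_zero σ⟩
      rw [map_zero, ← hP, hPc]
      exact (map_zero _).symm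
    · obtain ⟨a, ha⟩ := mem_range_of_mem_ringClassField hK jbar hc u.2
      obtain ⟨b, hb⟩ := mem_range_of_mem_ringClassField hK jbar hc v.2
      have huvC : (W.baseChange ℂ).toAffine.Nonsingular (u : ℂ) (v : ℂ) :=
        (WeierstrassCurve.Affine.baseChange_nonsingular W
          (f := (ringClassField K ι c).subtype.toRatAlgHom) (ringClassField K ι c).subtype.injective
          u v).mpr huv
      have hab : (W.baseChange Kbar).toAffine.Nonsingular a b := by
        rw [← WeierstrassCurve.Affine.baseChange_nonsingular W (f := jbar.toRatAlgHom) jbar.injective a b]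
        simpa [ha, hb] using huvC
      have hab' : ((W.baseChange K).map (Algebra.ofId K Kbar : K →+* Kbar)).toAffine.Nonsingular a b := by
        rw [hbc]; exact hab
      refine ⟨.some a b hab', ?_, fun σ hσ ↦ ?_⟩
      · have h1 : complexPoint W jbar (.some a b hab') =
            WeierstrassCurve.Affine.Point.map jbar.toRatAlgHom
              (WeierstrassCurve.Affine.Point.congrEquiv hbc (.some a b hab')) := rfl
        rw [h1, WeierstrassCurve.Affine.Point.congrEquiv_some hbc hab',
          WeierstrassCurve.Affine.Point.map_some, ← hP, hPc, WeierstrassCurve.Affine.Point.map_some]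
        simp only [RingHom.toRatAlgHom_apply, Subfield.coe_subtype, ha, hb]
      · have hσa : σ • a = a :=
          smul_eq_self_of_mem_ringClassSubgroup hK jbar hc hσ (by rw [ha]; exact u.2)
        have hσb : σ • b = b :=
          smul_eq_self_of_mem_ringClassSubgroup hK jbar hc hσ (by rw [hb]; exact v.2)
        rw [Field.absoluteGaloisGroup.smul_def] at hσa hσb
        change WeierstrassCurve.Affine.Point.map
          ((Field.absoluteGaloisGroup.toAlgEquiv K σ : Kbar ≃ₐ[K] Kbar) : Kbar →ₐ[K] Kbar)
          (.some a b hab') = .some a b hab'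
        rw [WeierstrassCurve.Affine.Point.map_some]
        simp only [AlgEquiv.coe_toAlgHom, hσa, hσb]
  obtain ⟨x, hx, hfix⟩ := key
  refine ⟨x, P, hx, hP, ⟨heegnerFormOfConductor (NumberField.discr K) β c, hQ', hQβ, ?_⟩, hfix⟩
  rw [hx]
  rfl

/-! ## §2 The vertical distribution relation in `E(K̄)` -/

/-- **`Tr_{K[p^{e+2}]/K[p^{e+1}]} P[p^{e+2}] = a_p · P[p^{e+1}] − P[p^e]` IN `E(K̄)`, over ANY transversal**
(Gross 1991 §3 Prop. 3.7 (i) / Darmon 2004 Prop. 3.10 (case `ℓ ∣ n`) / Perrin-Riou 1987 §3.1 / Howard 2004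
§2.7, for the principal points of one orientation `β`). For `E = W/ℚ` globally minimal at its own level
`N = N_E`, `K` imaginary quadratic with the Heegner hypothesis, `4N ∣ β² − d_K`, a good prime `p ∤ N`, points
`x₀, x₁, x₂ ∈ E(K̄)` whose complex points along `jbar` are the principal Heegner points of conductors
`p^e, p^{e+1}, p^{e+2}` (`exists_geomPoint_principal`; `x₂` read over `K[p^{e+2}]` through `P₂`), and ANY finite
transversal `R` of `Gal(K̄/K[p^{e+2}])` in `Gal(K̄/K[p^{e+1}])` (the shape of `IsHeegnerNormPoint`):
`∑_{r ∈ R} r • x₂ = a_p • x₁ − x₀`, `a_p = W.frobeniusTrace p`. Proof: the transversal sum is the Galois trace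
in `E(K[p^{e+2}])` (`exists_finset_ringClassGalOver_complexPoint_sum_smul_eq`), which is the tree's
`HeegnerTraceDividing.finsum_mem_ringClassGalOver_eq_frobeniusTrace_smul_sub` (Eichler–Shimura on the Hecke
neighbours); `complexPoint` is injective. [cite: Darmon2004, Prop. 3.10 (case ℓ ∣ n, pp. 35–36)]
[cite: GrossLMS1991, §3 Prop. 3.7 (i)] [cite: PerrinRiou1987BSMF, §3.1 (distribution relations)] -/
theorem sum_transversal_smul_eq_frobeniusTrace_smul_sub {W : WeierstrassCurve ℚ} [W.IsElliptic]
    [W.IsGloballyMinimal] [NeZero (W.conductorNorm ℤ)] (hK : IsImaginaryQuadratic K)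
    (hH : SatisfiesHeegnerHypothesis (W.conductorNorm ℤ) K)
    (Dt : ModularParametrizationData W (W.conductorNorm ℤ)) {β : ℤ}
    (hβ : (4 * (W.conductorNorm ℤ : ℕ) : ℤ) ∣ β ^ 2 - NumberField.discr K)
    (jbar : AlgebraicClosure K →+* ℂ) {p : ℕ} (hp : p.Prime) (hpN : ¬ p ∣ W.conductorNorm ℤ) (e : ℕ)
    {x₀ x₁ x₂ : WeierstrassCurve.geomPoints (W.baseChange K)}
    (hx₀ : complexPoint W jbar x₀ = heegnerPointComplexOfConductor Dt (NumberField.discr K) β (p ^ e))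
    (hx₁ : complexPoint W jbar x₁ = heegnerPointComplexOfConductor Dt (NumberField.discr K) β (p ^ (e + 1)))
    {P₂ : (W.baseChange (ringClassField K (jbar.comp (algebraMap K (AlgebraicClosure K))) (p ^ (e + 2)))).toAffine.Point}
    (hx₂ : complexPoint W jbar x₂ = WeierstrassCurve.Affine.Point.map (W' := W)
      (ringClassField K (jbar.comp (algebraMap K (AlgebraicClosure K))) (p ^ (e + 2))).subtype.toRatAlgHom P₂)
    (hP₂ : WeierstrassCurve.Affine.Point.map (W' := W)
      (ringClassField K (jbar.comp (algebraMap K (AlgebraicClosure K))) (p ^ (e + 2))).subtype.toRatAlgHom P₂ =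
      heegnerPointComplexOfConductor Dt (NumberField.discr K) β (p ^ (e + 2)))
    {R : Finset (Field.absoluteGaloisGroup K)} (hRsub : ∀ r ∈ R, r ∈ ringClassSubgroup K (p ^ (e + 1)) jbar)
    (htrans : ∀ τ ∈ ringClassSubgroup K (p ^ (e + 1)) jbar,
      ∃! r, r ∈ R ∧ r⁻¹ * τ ∈ ringClassSubgroup K (p ^ (e + 2)) jbar) :
    ∑ r ∈ R, r • x₂ = (W.frobeniusTrace p) • x₁ - x₀ := by
  have hp0 : 0 < p := hp.pos
  have hc : p ^ (e + 1) ≠ 0 := pow_ne_zero _ hp.ne_zero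
  have hc' : p ^ (e + 2) ≠ 0 := pow_ne_zero _ hp.ne_zero
  have hcc' : p ^ (e + 1) ∣ p ^ (e + 2) := pow_dvd_pow p (Nat.le_succ _)
  -- the transversal sum is the Galois trace in `E(K[p^{e+2}])`
  obtain ⟨G, hG, hsum⟩ := exists_finset_ringClassGalOver_complexPoint_sum_smul_eq W hK jbar hc hc' hcc'
    hx₂ hRsub htrans
  -- the trace relation for the principal points
  have hND : IsCoprime (W.conductorNorm ℤ : ℤ) (NumberField.discr K) := by
    have h := Literature.SatisfiesHeegnerHypothesis.coprime_discr hK.1 hH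
    refine Int.isCoprime_iff_gcd_eq_one.mpr ?_
    rw [Int.gcd_eq_natAbs, Int.natAbs_natCast]
    exact h
  have hpm : p ∣ p ^ (e + 1) := dvd_pow_self p (Nat.succ_ne_zero e)
  have hNm : Nat.Coprime (W.conductorNorm ℤ) (p ^ (e + 1)) :=
    Nat.Coprime.pow_right _ ((Nat.Prime.coprime_iff_not_dvd hp).mpr hpN).symm
  have hn : p * p ^ (e + 1) = p ^ (e + 2) := by rw [← pow_succ']
  have key := HeegnerTraceDividing.finsum_mem_ringClassGalOver_eq_frobeniusTrace_smul_sub hK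
    (jbar.comp (algebraMap K (AlgebraicClosure K))) Dt hND hβ hp hpN hpm hc hNm hn hP₂
  have hdiv : p ^ (e + 1) / p = p ^ e := by
    rw [pow_succ, Nat.mul_div_cancel _ hp0]
  rw [hdiv] at key
  -- rewrite the `∑ᶠ` over `Gal(K[p^{e+2}]/K[p^{e+1}])` as the sum over `G`
  have hGset : (ringClassGalOver (jbar.comp (algebraMap K (AlgebraicClosure K))) (p ^ (e + 2)) (p ^ (e + 1)) :
      Set (ringClassField K (jbar.comp (algebraMap K (AlgebraicClosure K))) (p ^ (e + 2)) ≃ₐ[ℚ] ringClassField K (jbar.comp (algebraMap K (AlgebraicClosure K))) (p ^ (e + 2)))) = ↑G := by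
    ext g
    rw [SetLike.mem_coe, Finset.mem_coe, hG]
  rw [hGset, finsum_mem_coe_finset, ← map_sum] at key
  -- compare complex points and conclude by injectivity
  apply complexPoint_injective W jbar
  rw [hsum, key, map_sub, map_zsmul, hx₁, hx₀]

end Literature.NumberTheory.EllipticCurves

end
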